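import Summits.NavierStokesRegularity.NavierStokesRegularity.Theorems.PerpetualPumpAveragedTypeIBlowupChainCriticalTools
import Summits.NavierStokesRegularity.NavierStokesRegularity.Theorems.PerpetualPumpAveragedTypeIBlowupKernelDeriv
import Mathlib.Analysis.SpecificLimits.Basic

/-!
# Crux `PerpetualPump.AveragedTypeIBlowup` (stmt-NavierStokesRegularity-1835), line `Sketch`:
# the stub `tailOfWeight` — the a-priori far tail above the front from the solution class

T. Tao, *Finite time blowup for an averaged three-dimensional Navier–Stokes equation*, J. Amer.
Math. Soc. **29** (2016), 601–674 = arXiv:1402.0290v3, §4 (4.5), (4.8), p. 22 (4.14): a solution of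
the exact Volterra chain in the class of Lemma 4.1 is bounded in the weight `(1+ε₀)^{20n}` on every
compact time interval, and the drive `quadTerm(Y)_{i,n}` is quadratic in the coefficients.

This file proves the registered stub `stub_tailOfWeight` of the lead's skeleton
`Cruxes/AveragedTypeIBlowup/Lines/Sketch.lean`, verbatim (let-free: the structure constants `α`, the
critical variables `b_n = −(1+ε₀)^{n/2}Y₀,ₙ`, `w_n = (1+ε₀)^{n/2}Y₁,ₙ` and the kernel majorants
`M0, M1` are bound variables pinned by defining equations). The window one-step theorem of the line
takes as hypothesis an a-priori FAR TAIL above the front `n ≥ n₀` on `[0,T]`: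
`|b_{n+j}| ≤ lad j`, `|w_{n+j}| ≤ lad j / 5`, `M0_{n+j}, M1_{n+j} ≤ lad j` for `j ≥ J`, with the ladder
profile `lad j = ε̄ (1+ε₀)^{-19(j-2)}`. It follows from the solution CLASS alone: the
`(1+ε₀)^{20n}`-bound `C` on `[0,T]` gives `|b_{n+j}|, |w_{n+j}| ≤ C(1+ε₀)^{-(39/2)(n+j)}`, which decays
by `(1+ε₀)^{-39/2}` per level against the profile's `(1+ε₀)^{-19}`; and, since `0 ≤ K ≤ 1` for the
inlined kernels `K_{i,n}(τ) = ∫ e^{-λ(ξ)τ}ρ_{i,n}(ξ) dξ` (`τ ≥ 0`) and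
`|quadTerm_{i,m}| ≤ K_α 2C² (1+ε₀)^{(75/2)(1-m)}` (the accepted `abs_quadTerm_le_of_weight`, weight
`20`), `M_{n+j} ≤ T K_α 2C² (1+ε₀)^{75/2} (1+ε₀)^{-37(n+j)}`, decaying by `(1+ε₀)^{-37}` per level
(the datum term of `M0` is absent for `n + j > n₀`). The threshold `J` is extracted from
`tendsto_pow_atTop_nhds_zero_of_lt_one` (`Filter.eventually_atTop`); the exponent bookkeeping writes
every weight as `exp` of a multiple of `log(1+ε₀)` (`tailOfWeight_weights`, `tailOfWeight_profile_eq`).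

Nothing here closes the item (`--supports`); no statement of the route changes.

## References

* T. Tao, J. Amer. Math. Soc. 29 (2016), 601–674, arXiv:1402.0290v3, §4 (4.5), (4.8), (4.14).
  [`Tao2016AveragedNS`]
-/

noncomputable section

-- the summit namespace `…NavierStokesRegularity.NavierStokesRegularity…` is the tree convention
set_option linter.dupNamespace false

open MeasureTheory Set Filter Topology
open scoped ENNReal
open Literature.Analysis.FluidPDE Literature.Analysis.FluidPDE.Tao2016
open Literature.Analysis.FluidPDE.TaoCascade (quadTerm IsSymmetricCoeff IsCancellingCoeff shiftSet)

namespace Summit.NavierStokesRegularity.NavierStokesRegularity.Theorems.PerpetualPumpAveragedTypeIBlowup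

variable {ε₀ : ℝ}

/-! ### The inlined kernels, the memory term, the exponent bookkeeping -/

/-- The mode heat kernel `K_{i,n}(τ) = ∫ e^{-λ(ξ)τ} ρ_{i,n}(ξ) dξ` lies in `[0,1]` for `τ ≥ 0`
(`ρ_{i,n} ≥ 0` has total mass `1`, `0 < e^{-λτ} ≤ 1`). [cite: Tao2016AveragedNS, §4 p. 22 (4.14)] -/
theorem tailOfWeight_kernel_mem {m : ℕ} (hε : 0 < 1 + ε₀) (𝒟 : CascadeWaveletData ε₀ m) (i : Fin m)
    (n : ℤ) {τ : ℝ} (hτ : 0 ≤ τ) :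
    0 ≤ ∫ ξ, Real.exp (-(heatRate ξ * τ)) * modeWeight 𝒟 i n ξ ∧
      ∫ ξ, Real.exp (-(heatRate ξ * τ)) * modeWeight 𝒟 i n ξ ≤ 1 := by
  refine ⟨integral_nonneg fun ξ => mul_nonneg (Real.exp_pos _).le (modeWeight_nonneg ξ), ?_⟩
  calc ∫ ξ, Real.exp (-(heatRate ξ * τ)) * modeWeight 𝒟 i n ξ ≤ ∫ ξ, modeWeight 𝒟 i n ξ :=
        integral_mono (integrable_exp_heatRate_mul_modeWeight hε 𝒟 i n τ) integrable_modeWeight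
          fun ξ => mul_le_of_le_one_left (modeWeight_nonneg ξ)
            (Real.exp_le_one_iff.2 (neg_nonpos.2 (mul_nonneg (heatRate_nonneg ξ) hτ)))
    _ = 1 := integral_modeWeight hε

/-- **The memory term against a kernel in `[0,1]`**: if `0 ≤ K ≤ 1` on `τ ≥ 0` and `|Q| ≤ B` on
`[0,T]`, then `∫₀ᵗ K(t-s)|Q(s)| ds ≤ B T` for `t ∈ [0,T]` (no integrability needed). [folklore] -/
theorem tailOfWeight_memory_le {K Q : ℝ → ℝ} {B T t : ℝ} (hK : ∀ τ, 0 ≤ τ → 0 ≤ K τ ∧ K τ ≤ 1)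
    (hB : 0 ≤ B) (hQ : ∀ s ∈ Icc 0 T, |Q s| ≤ B) (ht : t ∈ Icc 0 T) :
    ∫ s in (0 : ℝ)..t, K (t - s) * |Q s| ≤ B * T := by
  have h := intervalIntegral.norm_integral_le_of_norm_le_const (a := 0) (b := t) (C := B)
    (f := fun s => K (t - s) * |Q s|) fun s hs => by
      rw [uIoc_of_le ht.1] at hs
      rw [Real.norm_eq_abs, abs_mul, abs_abs, abs_of_nonneg (hK _ (sub_nonneg.2 hs.2)).1]
      calc K (t - s) * |Q s| ≤ 1 * B :=
            mul_le_mul (hK _ (sub_nonneg.2 hs.2)).2 (hQ s ⟨hs.1.le, hs.2.trans ht.2⟩)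
              (abs_nonneg _) zero_le_one
        _ = B := one_mul B
  rw [sub_zero, abs_of_nonneg ht.1, Real.norm_eq_abs] at h
  calc ∫ s in (0 : ℝ)..t, K (t - s) * |Q s| ≤ |(∫ s in (0 : ℝ)..t, K (t - s) * |Q s|)| :=
        le_abs_self _
    _ ≤ B * t := h
    _ ≤ B * T := mul_le_mul_of_nonneg_left ht.2 hB

/-- The ladder profile as an exponential: `((L)^{19(j-2)})⁻¹ = exp(log L · (38 - 19j))` for `j ≥ 2`.
[folklore] -/
theorem tailOfWeight_profile_eq {L : ℝ} (hL : 0 < L) {j : ℕ} (hj : 2 ≤ j) :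
    (L ^ (19 * (j - 2)))⁻¹ = Real.exp (Real.log L * (38 - 19 * (j : ℝ))) := by
  conv_lhs => rw [← Real.exp_log hL]
  rw [← Real.exp_nat_mul, ← Real.exp_neg]
  congr 1
  push_cast [Nat.cast_sub hj]
  ring

/-- **Exponent bookkeeping of the far tail** (`L = 1+ε₀`, `m = n + j`): the critical weight times the
class decay, `L^{m/2} L^{-20m} = L^{-(39/2)n-38} (L^{-1/2})^j L^{38-19j}`, and the critical weight times
the drive decay, `L^{m/2} L^{(75/2)(1-m)} = L^{75/2-37n-38} (L^{-18})^j L^{38-19j}`. [folklore] -/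
theorem tailOfWeight_weights {L : ℝ} (hL : 0 < L) (n : ℤ) (j : ℕ) :
    L ^ (((n + j : ℤ) : ℝ) / 2) * L ^ (-((20 : ℝ) * ((n + j : ℤ) : ℝ))) =
      Real.exp (Real.log L * (-(39 / 2) * (n : ℝ) - 38)) * Real.exp (-(Real.log L / 2)) ^ j *
        Real.exp (Real.log L * (38 - 19 * (j : ℝ))) ∧
    L ^ (((n + j : ℤ) : ℝ) / 2) * L ^ ((2 * (20 : ℝ) - 5 / 2) * (1 - ((n + j : ℤ) : ℝ))) =
      Real.exp (Real.log L * (75 / 2 - 37 * (n : ℝ) - 38)) * Real.exp (-(18 * Real.log L)) ^ j *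
        Real.exp (Real.log L * (38 - 19 * (j : ℝ))) := by
  simp only [Real.rpow_def_of_pos hL, ← Real.exp_nat_mul, ← Real.exp_add]
  constructor <;> congr 1 <;> push_cast <;> ring

/-! ### The registered stub -/

/-- **Stub `tailOfWeight`** (a-priori far tail above the front, from the solution class). For a solution
of the chain in the class (no modes below `n₀`, `(1+ε₀)^{20n}`-bounded on every `[0,S']`, `S' < S`),
with the structure constants `α`, the critical variables `b, w` and the kernel majorants `M0, M1` pinned
by defining equations: for every front `n ≥ n₀` and `0 < T < S` there is `J` with, for all `j ≥ J` and
`t ∈ [0,T]`, `|b_{n+j}(t)| ≤ lad j`, `|w_{n+j}(t)| ≤ lad j / 5`, `M0_{n+j}(t) ≤ lad j`, `M1_{n+j}(t) ≤ lad j`,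
`lad j = ε̄ ((1+ε₀)^{19(j-2)})⁻¹` (class decay `(1+ε₀)^{-39/2}`, resp. `(1+ε₀)^{-37}` for the quadratic
majorants, per level beats the profile's `(1+ε₀)^{-19}`). [cite: Tao2016AveragedNS, §4 (4.5), (4.8), (4.14)] -/
theorem stub_tailOfWeight :
    ∀ {ε₀ : ℝ}, 0 < ε₀ → ε₀ ≤ 1 → ∀ (𝒟 : CascadeWaveletData ε₀ 2) (Dc εb : ℝ) (n₀ : ℤ) (A S : ℝ)
      (Y : Fin 2 → ℤ → ℝ → ℝ) (α : Fin 2 → Fin 2 → Fin 2 → ℤ × ℤ × ℤ → ℝ) (bv wv M0 M1 : ℤ → ℝ → ℝ),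
      α = (fun (i₁ i₂ i₃ : Fin 2) (μ : ℤ × ℤ × ℤ) =>
          if i₁ = 1 ∧ i₂ = 1 ∧ i₃ = 0 ∧ μ = (0, 0, 0) then Dc else
          if i₁ = 1 ∧ i₂ = 0 ∧ i₃ = 1 ∧ μ = (0, 0, 0) then -Dc / 2 else
          if i₁ = 0 ∧ i₂ = 1 ∧ i₃ = 1 ∧ μ = (0, 0, 0) then -Dc / 2 else
          if i₁ = 1 ∧ i₂ = 0 ∧ i₃ = 1 ∧ μ = (0, 1, 0) then Dc / 2 else
          if i₁ = 0 ∧ i₂ = 1 ∧ i₃ = 1 ∧ μ = (1, 0, 0) then Dc / 2 else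
          if i₁ = 1 ∧ i₂ = 1 ∧ i₃ = 0 ∧ μ = (0, 0, 1) then -Dc else
          if i₁ = 0 ∧ i₂ = 0 ∧ i₃ = 1 ∧ μ = (0, 0, 0) then εb * Dc else
          if i₁ = 0 ∧ i₂ = 1 ∧ i₃ = 0 ∧ μ = (0, 0, 0) then -(εb * Dc) / 2 else
          if i₁ = 1 ∧ i₂ = 0 ∧ i₃ = 0 ∧ μ = (0, 0, 0) then -(εb * Dc) / 2 else 0) →
      0 < Dc → 0 < εb → 0 < S →
      (∀ i n, ContinuousOn (Y i n) (Ico 0 S)) →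
      (∀ i n t, n < n₀ → Y i n t = 0) →
      (∀ S' : ℝ, S' < S → ∃ C : ℝ, ∀ (i : Fin 2) (n : ℤ), ∀ t ∈ Icc 0 S',
        (1 + ε₀) ^ ((20 : ℝ) * n) * |Y i n t| ≤ C) →
      (∀ (n : ℤ) (t : ℝ), bv n t = -((1 + ε₀) ^ ((n : ℝ) / 2) * Y 0 n t)) →
      (∀ (n : ℤ) (t : ℝ), wv n t = (1 + ε₀) ^ ((n : ℝ) / 2) * Y 1 n t) →
      (∀ (n : ℤ) (t : ℝ), M0 n t = (1 + ε₀) ^ ((n : ℝ) / 2) *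
        ((if n = n₀ then |A| else 0) * (∫ ξ, Real.exp (-(heatRate ξ * t)) * modeWeight 𝒟 0 n ξ) +
          ∫ s in (0 : ℝ)..t, (∫ ξ, Real.exp (-(heatRate ξ * (t - s))) * modeWeight 𝒟 0 n ξ) *
            |quadTerm ε₀ α Y 0 n s|)) →
      (∀ (n : ℤ) (t : ℝ), M1 n t = (1 + ε₀) ^ ((n : ℝ) / 2) *
        ∫ s in (0 : ℝ)..t, (∫ ξ, Real.exp (-(heatRate ξ * (t - s))) * modeWeight 𝒟 1 n ξ) *
          |quadTerm ε₀ α Y 1 n s|) →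
      ∀ (n : ℤ) (T : ℝ), n₀ ≤ n → 0 < T → T < S →
        ∃ J : ℕ, ∀ j : ℕ, J ≤ j → ∀ t ∈ Icc 0 T,
          |bv (n + j) t| ≤ εb * ((1 + ε₀) ^ (19 * (j - 2)))⁻¹ ∧
          |wv (n + j) t| ≤ εb * ((1 + ε₀) ^ (19 * (j - 2)))⁻¹ / 5 ∧
          M0 (n + j) t ≤ εb * ((1 + ε₀) ^ (19 * (j - 2)))⁻¹ ∧
          M1 (n + j) t ≤ εb * ((1 + ε₀) ^ (19 * (j - 2)))⁻¹ := by
  intro ε₀ hε₀ _ 𝒟 Dc εb n₀ A S Y α bv wv M0 M1 _ _ hεb _ _ _ hclass hbv hwv hM0 hM1 n T hn hT hTS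
  have hL : 0 < 1 + ε₀ := by linarith
  obtain ⟨C, hC⟩ := hclass T hTS
  have hC0 : 0 ≤ C :=
    le_trans (mul_nonneg (Real.rpow_nonneg hL.le _) (abs_nonneg _)) (hC 0 0 0 ⟨le_rfl, hT.le⟩)
  have hYb : ∀ (i : Fin 2) (k : ℤ), ∀ s ∈ Icc 0 T, |Y i k s| ≤ C * (1 + ε₀) ^ (-((20 : ℝ) * k)) :=
    fun i k s hs => (weight_mul_abs_le_iff hL _ _ _).1 (hC i k s hs)
  have hQ : ∀ (i : Fin 2) (m : ℤ), ∀ s ∈ Icc 0 T, |quadTerm ε₀ α Y i m s| ≤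
      (∑ i₁ : Fin 2, ∑ i₂ : Fin 2, ∑ μ ∈ shiftSet, |α i₁ i₂ i μ|) * (2 * C * C) *
        (1 + ε₀) ^ ((2 * (20 : ℝ) - 5 / 2) * (1 - (m : ℝ))) :=
    fun i m s hs => abs_quadTerm_le_of_weight hε₀ (by norm_num) α hC0 (fun j k => hYb j k s hs) i m
  have hP : ∀ m : ℤ, 0 < (1 + ε₀) ^ ((m : ℝ) / 2) := fun m => Real.rpow_pos_of_pos hL _
  have hK : ∀ (i : Fin 2) (m : ℤ) (τ : ℝ), 0 ≤ τ →
      0 ≤ ∫ ξ, Real.exp (-(heatRate ξ * τ)) * modeWeight 𝒟 i m ξ ∧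
        ∫ ξ, Real.exp (-(heatRate ξ * τ)) * modeWeight 𝒟 i m ξ ≤ 1 :=
    fun i m τ hτ => tailOfWeight_kernel_mem hL 𝒟 i m hτ
  -- the geometric ratios
  have hℓ : 0 < Real.log (1 + ε₀) := Real.log_pos (by linarith)
  have hr₁ : Real.exp (-(Real.log (1 + ε₀) / 2)) < 1 := Real.exp_lt_one_iff.2 (by linarith)
  have hr₂ : Real.exp (-(18 * Real.log (1 + ε₀))) < 1 := Real.exp_lt_one_iff.2 (by linarith)
  have t1 : Tendsto (fun j : ℕ => C * Real.exp (Real.log (1 + ε₀) * (-(39 / 2) * (n : ℝ) - 38)) *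
      Real.exp (-(Real.log (1 + ε₀) / 2)) ^ j) atTop (𝓝 0) := by
    simpa using (tendsto_pow_atTop_nhds_zero_of_lt_one (Real.exp_pos _).le hr₁).const_mul
      (C * Real.exp (Real.log (1 + ε₀) * (-(39 / 2) * (n : ℝ) - 38)))
  have t2 : ∀ i : Fin 2, Tendsto (fun j : ℕ =>
      T * ((∑ i₁ : Fin 2, ∑ i₂ : Fin 2, ∑ μ ∈ shiftSet, |α i₁ i₂ i μ|) * (2 * C * C)) *
        Real.exp (Real.log (1 + ε₀) * (75 / 2 - 37 * (n : ℝ) - 38)) *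
          Real.exp (-(18 * Real.log (1 + ε₀))) ^ j) atTop (𝓝 0) := fun i => by
    simpa using (tendsto_pow_atTop_nhds_zero_of_lt_one (Real.exp_pos _).le hr₂).const_mul
      (T * ((∑ i₁ : Fin 2, ∑ i₂ : Fin 2, ∑ μ ∈ shiftSet, |α i₁ i₂ i μ|) * (2 * C * C)) *
        Real.exp (Real.log (1 + ε₀) * (75 / 2 - 37 * (n : ℝ) - 38)))
  have hεb5 : (0 : ℝ) < εb / 5 := by positivity
  obtain ⟨J, hJ⟩ := eventually_atTop.1 ((eventually_ge_atTop 2).and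
    ((t1.eventually_le_const hεb5).and (((t2 0).eventually_le_const hεb).and
      ((t2 1).eventually_le_const hεb))))
  refine ⟨J, fun j hj t ht => ?_⟩
  obtain ⟨hj2, d1, d2, d3⟩ := hJ j hj
  have hW : 0 < Real.exp (Real.log (1 + ε₀) * (38 - 19 * (j : ℝ))) := Real.exp_pos _
  obtain ⟨E1, E2⟩ := tailOfWeight_weights hL n j
  have hm : n + (j : ℤ) ≠ n₀ := by omega
  -- the critical variables
  have hbw : ∀ i : Fin 2, (1 + ε₀) ^ (((n + j : ℤ) : ℝ) / 2) * |Y i (n + j) t| ≤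
      εb / 5 * Real.exp (Real.log (1 + ε₀) * (38 - 19 * (j : ℝ))) := fun i =>
    calc (1 + ε₀) ^ (((n + j : ℤ) : ℝ) / 2) * |Y i (n + j) t|
        ≤ (1 + ε₀) ^ (((n + j : ℤ) : ℝ) / 2) * (C * (1 + ε₀) ^ (-((20 : ℝ) * ((n + j : ℤ) : ℝ)))) :=
          mul_le_mul_of_nonneg_left (hYb i _ t ht) (hP _).le
      _ = C * ((1 + ε₀) ^ (((n + j : ℤ) : ℝ) / 2) * (1 + ε₀) ^ (-((20 : ℝ) * ((n + j : ℤ) : ℝ)))) := by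
          ring
      _ = C * Real.exp (Real.log (1 + ε₀) * (-(39 / 2) * (n : ℝ) - 38)) *
            Real.exp (-(Real.log (1 + ε₀) / 2)) ^ j *
              Real.exp (Real.log (1 + ε₀) * (38 - 19 * (j : ℝ))) := by rw [E1]; ring
      _ ≤ εb / 5 * Real.exp (Real.log (1 + ε₀) * (38 - 19 * (j : ℝ))) :=
          mul_le_mul_of_nonneg_right d1 hW.le
  -- the majorants
  have hmaj : ∀ i : Fin 2, (1 + ε₀) ^ (((n + j : ℤ) : ℝ) / 2) *
      ∫ s in (0 : ℝ)..t, (∫ ξ, Real.exp (-(heatRate ξ * (t - s))) * modeWeight 𝒟 i (n + j) ξ) *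
        |quadTerm ε₀ α Y i (n + j) s| ≤
      εb * Real.exp (Real.log (1 + ε₀) * (38 - 19 * (j : ℝ))) := fun i => by
    have hB : 0 ≤ (∑ i₁ : Fin 2, ∑ i₂ : Fin 2, ∑ μ ∈ shiftSet, |α i₁ i₂ i μ|) * (2 * C * C) *
        (1 + ε₀) ^ ((2 * (20 : ℝ) - 5 / 2) * (1 - ((n + j : ℤ) : ℝ))) := by positivity
    have hmem : ∫ s in (0 : ℝ)..t,
        (∫ ξ, Real.exp (-(heatRate ξ * (t - s))) * modeWeight 𝒟 i (n + j) ξ) *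
          |quadTerm ε₀ α Y i (n + j) s| ≤
        (∑ i₁ : Fin 2, ∑ i₂ : Fin 2, ∑ μ ∈ shiftSet, |α i₁ i₂ i μ|) * (2 * C * C) *
          (1 + ε₀) ^ ((2 * (20 : ℝ) - 5 / 2) * (1 - ((n + j : ℤ) : ℝ))) * T :=
      tailOfWeight_memory_le
        (K := fun τ => ∫ ξ, Real.exp (-(heatRate ξ * τ)) * modeWeight 𝒟 i (n + j) ξ)
        (Q := fun s => quadTerm ε₀ α Y i (n + j) s) (hK i (n + j)) hB (hQ i (n + j)) ht
    have d : T * ((∑ i₁ : Fin 2, ∑ i₂ : Fin 2, ∑ μ ∈ shiftSet, |α i₁ i₂ i μ|) * (2 * C * C)) *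
        Real.exp (Real.log (1 + ε₀) * (75 / 2 - 37 * (n : ℝ) - 38)) *
          Real.exp (-(18 * Real.log (1 + ε₀))) ^ j ≤ εb := by
      fin_cases i
      · exact d2
      · exact d3
    calc (1 + ε₀) ^ (((n + j : ℤ) : ℝ) / 2) *
          ∫ s in (0 : ℝ)..t, (∫ ξ, Real.exp (-(heatRate ξ * (t - s))) * modeWeight 𝒟 i (n + j) ξ) *
            |quadTerm ε₀ α Y i (n + j) s|
        ≤ (1 + ε₀) ^ (((n + j : ℤ) : ℝ) / 2) *
            ((∑ i₁ : Fin 2, ∑ i₂ : Fin 2, ∑ μ ∈ shiftSet, |α i₁ i₂ i μ|) * (2 * C * C) *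
              (1 + ε₀) ^ ((2 * (20 : ℝ) - 5 / 2) * (1 - ((n + j : ℤ) : ℝ))) * T) :=
          mul_le_mul_of_nonneg_left hmem (hP _).le
      _ = T * ((∑ i₁ : Fin 2, ∑ i₂ : Fin 2, ∑ μ ∈ shiftSet, |α i₁ i₂ i μ|) * (2 * C * C)) *
            ((1 + ε₀) ^ (((n + j : ℤ) : ℝ) / 2) *
              (1 + ε₀) ^ ((2 * (20 : ℝ) - 5 / 2) * (1 - ((n + j : ℤ) : ℝ)))) := by ring
      _ = T * ((∑ i₁ : Fin 2, ∑ i₂ : Fin 2, ∑ μ ∈ shiftSet, |α i₁ i₂ i μ|) * (2 * C * C)) *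
            Real.exp (Real.log (1 + ε₀) * (75 / 2 - 37 * (n : ℝ) - 38)) *
              Real.exp (-(18 * Real.log (1 + ε₀))) ^ j *
                Real.exp (Real.log (1 + ε₀) * (38 - 19 * (j : ℝ))) := by rw [E2]; ring
      _ ≤ εb * Real.exp (Real.log (1 + ε₀) * (38 - 19 * (j : ℝ))) :=
          mul_le_mul_of_nonneg_right d hW.le
  have hεW := mul_pos hεb hW
  refine ⟨?_, ?_, ?_, ?_⟩
  · rw [hbv, abs_neg, abs_mul, abs_of_pos (hP _), tailOfWeight_profile_eq hL hj2]
    linarith [hbw 0]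
  · rw [hwv, abs_mul, abs_of_pos (hP _), tailOfWeight_profile_eq hL hj2]
    linarith [hbw 1]
  · rw [hM0, if_neg hm, zero_mul, zero_add, tailOfWeight_profile_eq hL hj2]
    exact hmaj 0
  · rw [hM1, tailOfWeight_profile_eq hL hj2]
    exact hmaj 1

end Summit.NavierStokesRegularity.NavierStokesRegularity.Theorems.PerpetualPumpAveragedTypeIBlowup

end
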